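import Summits.RiemannHypothesis.RiemannHypothesis.Theses.UniversalFactor
import Summits.RiemannHypothesis.RiemannHypothesis.Theorems.UniversalFactorLaplaceLoopholeKillPath
import Summits.RiemannHypothesis.RiemannHypothesis.Theorems.UniversalFactorMediumKernelNoGo
import Summits.RiemannHypothesis.RiemannHypothesis.Theorems.UniversalFactorNarrowKernelNoGo
import Summits.RiemannHypothesis.RiemannHypothesis.Theorems.LaplaceLoophole.Negative.LaplaceLoopholeWideWindow

/-!
# RiemannHypothesis / UniversalFactor — REFUTATION of the target `LaplaceLoophole` (stmt-RiemannHypothesis-2575)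

Refutes `UniversalFactor.LaplaceLoophole` [refuted-substantive]: there is NO `a > 0` for which the
Laplace(`a`)-smoothed transform `F_a(z) = ∫₀^∞ Φ(u)(1 + u²/a²)⁻¹ cos(zu) du` of the Pólya–de Bruijn kernel has
only real zeros — generalised Newman holds on the whole Laplace ray of de Bruijn's universal-factor cone
(Cardon's Question 7 answered in the negative, as Cardon expected).  Witness, for every `a > 0` a
non-real zero of `F_a`, by the route's own kill path `not_laplaceLoophole_of_noGo` with all four no-go windows
now theorems of the tree:
* `a ≥ 32` — `UniversalFactor.narrowKernelNoGo` (analytic: log-free energy gap of the Lorentz-filtered Hardy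
  function + L²-pigeonhole + three zeta ordinates in a zero-free window + Laguerre interlacing);
* `π/8 ≤ a ≤ 32` — `UniversalFactor.OneSidedAverageSignTest.MediumKernelNoGo_proof` (certified one-point
  Laguerre certificates, windows A/B/C at `x = 64.6, 222.8, 223.2` and the Lehmer point `x₀ = 14010.16`);
* `0 < a < π/8` — `UniversalFactor.not_hasOnlyRealZeros_laplace_of_lt_pi_div_eight`
  (`LaplaceLoophole/Negative/LaplaceLoopholeWideWindow.lean`): residue `∫H_0 cosh(a·) = (π/2)Φ_ℂ(ia) > 0` for
  `a ≤ 0.3188` by 18 kernel-checked theta cells and the PROVED `WideKernelNoGo`; dip certificate at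
  `x = 41.9` for `a ∈ [0.300, 0.326]` (through the residue zero `a₀ = 0.3194150268…`, the only place where the
  exceptional branch `ExceptionalWideNoGo` has content); hump certificate at `x = 64.6` for
  `a ∈ [0.324, 0.392698]`; window A above.
No cheap repair exists: the statement is false at EVERY `a > 0` (not at a degenerate or boundary value), the
side condition `0 < a` is exactly what separates it from RH itself (`a = 0` collapses `F_a` to `H_0`:
`UniversalFactor.exists_hasOnlyRealZeros_laplace_iff_riemannHypothesis`), and by `MixedFactorReduction` +
`rodgers_tao_holds` every finite universal factor `e^{λu²}∏(1 + u²/a_k²)` inherits the failure, so no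
re-parametrisation of the kernel family inside de Bruijn's cone survives; the only true weakening is the
assembly `LaplaceLoophole → RH`, which is vacuous.  barrier-candidate: UniversalFactorNewman — no
Pólya-frequency (universal-factor) smoothing of `Ξ` is in the Laguerre–Pólya class; any programme
"`Ξ = T[Ψ]` with `T` a universal-factor operator and `Ψ` provably LP" is dead (extends
`Literature.Barriers.RiemannHypothesis.NewmanConjecture` from the heat ray to the whole cone).
-/

noncomputable section

set_option linter.dupNamespace false

namespace Summit.RiemannHypothesis.RiemannHypothesis.Theorems

open Literature.NumberTheory.LFunctions

/-- Refutes `UniversalFactor.LaplaceLoophole` [refuted-substantive]: for EVERY `a > 0` the Laplace(`a`)-smoothed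
transform `F_a = deBruijnHDiv (1 + u²/a²)` of the Pólya–de Bruijn kernel has a non-real zero (generalised Newman
on the Laplace ray); witness = the kill path `not_laplaceLoophole_of_noGo` fed with the four proved windows
(`narrowKernelNoGo`, `MediumKernelNoGo_proof`, `WideKernelNoGo_holds`, and the wide window
`not_hasOnlyRealZeros_laplace_of_lt_pi_div_eight`, which makes the exceptional branch unconditional).
No cheap repair: false at every `a > 0`; dropping `0 < a` gives RH itself; every finite universal factor inherits
the failure by `MixedFactorReduction`. barrier-candidate: UniversalFactorNewman. [folklore] -/
theorem UniversalFactorLaplaceLoophole_refuted :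
    ¬ _root_.Summit.RiemannHypothesis.RiemannHypothesis.Theses.UniversalFactor.LaplaceLoophole :=
  not_laplaceLoophole_of_noGo UniversalFactor.narrowKernelNoGo
    UniversalFactor.OneSidedAverageSignTest.MediumKernelNoGo_proof
    _root_.Summit.RiemannHypothesis.RiemannHypothesis.Theses.UniversalFactor.WideKernelNoGo_holds
    (fun _a ha ha' h0 => UniversalFactor.not_hasOnlyRealZeros_laplace_of_integral_cosh_eq_zero ha ha' h0)

end Summit.RiemannHypothesis.RiemannHypothesis.Theorems
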